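import Literature.MathematicalPhysics.QuantumFieldTheory.ConformalBootstrap3D.PointKernelK34L505Data
import Literature.MathematicalPhysics.QuantumFieldTheory.ConformalBootstrap3D.PointKernelK34L505Segs

/-!
# K34L505 certificate, kernel block file M0: (M) rows per `s`-piece, 9 row groups

`decide` by kernel reduction of the (M) block checker `PCert.mBlockOK` of `PointKernel` on the piece
certificates `pc2_0K34L505` / `pc2_1K34L505` (corner numbers on the `s`-halves `[101/200, 203/400]`, `[203/400, 51/100]`)
and the row data `mrowsAK34L505` / `mrowsBK34L505` of `PointKernelK34L505Data`; soundness is `PCert.mBlockOK_sound`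
(assembled by `PCert.boxExcluded_of_kernelC_lowerSM`, `PointKernelLowerM`).  Estimated kernel time 243 s.
-/

set_option maxRecDepth 100000
set_option maxHeartbeats 0

namespace Literature.MathematicalPhysics.QuantumFieldTheory.ConformalBootstrap3D.PointKernelK34L505

open Literature.MathematicalPhysics.QuantumFieldTheory.ConformalBootstrap3D.PointKernel

/-- (M) rows `[0, 17)` of piece 0 (`mrowsAK34L505` on `pc2_0K34L505`) pass the kernel evaluator. [folklore] -/
theorem mBlock_0_0 : pc2_0K34L505.mBlockOK mrowsAK34L505 0 17 = true := by
  decide +kernel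

/-- (M) rows `[17, 23)` of piece 0 (`mrowsAK34L505` on `pc2_0K34L505`) pass the kernel evaluator. [folklore] -/
theorem mBlock_0_17 : pc2_0K34L505.mBlockOK mrowsAK34L505 17 23 = true := by
  decide +kernel

/-- (M) rows `[23, 24)` of piece 0 (`mrowsAK34L505` on `pc2_0K34L505`) pass the kernel evaluator. [folklore] -/
theorem mBlock_0_23 : pc2_0K34L505.mBlockOK mrowsAK34L505 23 24 = true := by
  decide +kernel

/-- (M) rows `[24, 26)` of piece 0 (`mrowsAK34L505` on `pc2_0K34L505`) pass the kernel evaluator. [folklore] -/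
theorem mBlock_0_24 : pc2_0K34L505.mBlockOK mrowsAK34L505 24 26 = true := by
  decide +kernel

/-- (M) rows `[26, 33)` of piece 0 (`mrowsAK34L505` on `pc2_0K34L505`) pass the kernel evaluator. [folklore] -/
theorem mBlock_0_26 : pc2_0K34L505.mBlockOK mrowsAK34L505 26 33 = true := by
  decide +kernel

/-- (M) rows `[33, 48)` of piece 0 (`mrowsAK34L505` on `pc2_0K34L505`) pass the kernel evaluator. [folklore] -/
theorem mBlock_0_33 : pc2_0K34L505.mBlockOK mrowsAK34L505 33 48 = true := by
  decide +kernel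

/-- (M) rows `[0, 17)` of piece 1 (`mrowsBK34L505` on `pc2_1K34L505`) pass the kernel evaluator. [folklore] -/
theorem mBlock_1_0 : pc2_1K34L505.mBlockOK mrowsBK34L505 0 17 = true := by
  decide +kernel

/-- (M) rows `[17, 23)` of piece 1 (`mrowsBK34L505` on `pc2_1K34L505`) pass the kernel evaluator. [folklore] -/
theorem mBlock_1_17 : pc2_1K34L505.mBlockOK mrowsBK34L505 17 23 = true := by
  decide +kernel

/-- (M) rows `[23, 24)` of piece 1 (`mrowsBK34L505` on `pc2_1K34L505`) pass the kernel evaluator. [folklore] -/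
theorem mBlock_1_23 : pc2_1K34L505.mBlockOK mrowsBK34L505 23 24 = true := by
  decide +kernel

end Literature.MathematicalPhysics.QuantumFieldTheory.ConformalBootstrap3D.PointKernelK34L505
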